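import Summits.AtomisticToContinuum.FouriersLaw.Theorems.BondHeatUncertaintyLinearResponseFTUREntropyBalanceHelper3
import Summits.AtomisticToContinuum.FouriersLaw.Theorems.BondHeatUncertaintyLinearResponseFTUREquilibriumBondHeatVariance
import Summits.AtomisticToContinuum.FouriersLaw.Theorems.BondHeatUncertaintySubdiffusiveBondHeatKernelGibbsA

/-!
# Entropy balance (K4), helper 4: the endpoint–heat law `fluxLaw`, its marginals and the heats

Helper file for crux `stmt-AtomisticToContinuum-9122` (`BondHeatUncertainty.LinearResponseFTUR`), line
`lebesgue-flip-duality`, stub `stub_entropyBalance`. Structure of the law `fluxLaw P N i0 iN ib T_L T_R t μ`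
on the observable space `Obs N` (image of `μ ⊗ W` under the raw observable of the damped path):

* `pinnedChain_measurable_intervalIntegral_solMap` — `(x, ω) ↦ ∫₀ᵗ g(z_s) ds` is measurable;
* `pinnedChain_map_solMap_real_of_invariant` — the one-time law `law(z_t) = μ` at a real time `t ≥ 0`;
* `pinnedChain_integrable_momentum_mul_partialQ` — the work-rate observable `p_i ∂_{q_i}H` and the kinetic
  energy `p_i²/2` are in `L¹(μ)` as soon as `e^{ϑH} ∈ L¹(μ)` for some `ϑ > 0` (linear force bound of the
  confining pinned chain: `|p_i ∂_{q_i}H| ≤ K_E (1 + H)² ≤ C_ϑ e^{ϑH}`);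
* `fluxLaw_map_fst`, `fluxLaw_map_endpoint` — its `x_0`-marginal is `μ`, and, for `μ` invariant under the
  constructed kernels, so is its `x_t`-marginal;
* `integrable_heats_fluxLaw` (registered sub-goal) — both bath heats are integrable under `fluxLaw μ` for
  an invariant `μ` with an exponential moment.

(Measurability of the raw observable is the sibling stub's
`EquilibriumBondHeatVariance.measurable_rawObs_fwdPath`; `fluxLaw (ρ·Leb) = ρ(x_0)·fluxLaw Leb`,
σ-finiteness of `fluxLaw Leb` and the flip-duality reading of the heat-flux detailed balance are in the
stub file `…EntropyBalance.lean`, next to their only use.)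
-/

noncomputable section

namespace Summit.AtomisticToContinuum.FouriersLaw.Theorems.LinearResponseFTUR

open MeasureTheory ProbabilityTheory Filter Topology Set
open scoped NNReal ENNReal
open Literature.MathematicalPhysics.KineticTheory
open Literature.MathematicalPhysics.KineticTheory.HeatConduction
open Literature.Probability.Process
open Summit.AtomisticToContinuum.FouriersLaw.Theorems.BondHeatUncertainty
open Summit.AtomisticToContinuum.FouriersLaw.Theorems.SubdiffusiveBondHeat

section Law

variable {ω₂ lam β γ : ℝ} (hω : 0 < ω₂) (hl : 0 ≤ lam) (hβ : 0 ≤ β) (hγ : 0 ≤ γ) (N : ℕ) (T_L T_R : ℝ)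
include hω hl hβ hγ

/-- Time integrals of a measurable observable along the constructed flow depend measurably on the
start and the driving pair: `(x, ω) ↦ ∫₀ᵗ g(Φ_s(x, B(ω))) ds` is measurable. [folklore] -/
theorem pinnedChain_measurable_intervalIntegral_solMap {g : PhaseSpace N → ℝ} (hg : Measurable g)
    (t : ℝ) :
    Measurable fun p : PhaseSpace N × WienerPair =>
      ∫ s in (0 : ℝ)..t, g ((pinnedChain ω₂ lam β γ).solMap N T_L T_R s p.1 (pairPath p.2)) := by
  have hZ := pinnedChain_measurable_solMap_process hω hl hβ hγ N T_L T_R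
  have hG : Measurable fun w : (PhaseSpace N × WienerPair) × ℝ =>
      g ((pinnedChain ω₂ lam β γ).solMap N T_L T_R w.2 w.1.1 (pairPath w.1.2)) := by
    have h1 : Measurable fun w : (PhaseSpace N × WienerPair) × ℝ => (w.2, w.1) :=
      measurable_snd.prodMk measurable_fst
    have h2 := hg.comp (hZ.comp h1)
    exact h2
  have h1 : ∀ a b : ℝ, Measurable fun p : PhaseSpace N × WienerPair =>
      ∫ s in Ioc a b, g ((pinnedChain ω₂ lam β γ).solMap N T_L T_R s p.1 (pairPath p.2)) := by
    intro a b
    have h3 : StronglyMeasurable fun p : PhaseSpace N × WienerPair =>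
        ∫ s, (fun w : (PhaseSpace N × WienerPair) × ℝ =>
          g ((pinnedChain ω₂ lam β γ).solMap N T_L T_R w.2 w.1.1 (pairPath w.1.2))) (p, s)
          ∂((volume : Measure ℝ).restrict (Ioc a b)) :=
      hG.stronglyMeasurable.integral_prod_right'
    exact h3.measurable
  simp only [intervalIntegral]
  exact (h1 0 t).sub (h1 t 0)

/-- **One-time law at a real time `t ≥ 0`** (`map` form): `law(z_t) = μ`. [folklore] -/
theorem pinnedChain_map_solMap_real_of_invariant (μ : Measure (PhaseSpace N)) [SFinite μ]
    (hinv : ∀ s : ℝ≥0, μ.bind ((pinnedChain ω₂ lam β γ).transitionKernel N T_L T_R s) = μ)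
    {t : ℝ} (ht : 0 ≤ t) :
    (μ.prod wienerPair).map
        (fun p => (pinnedChain ω₂ lam β γ).solMap N T_L T_R t p.1 (pairPath p.2)) = μ := by
  have h := pinnedChain_map_solMap_of_invariant hω hl hβ hγ N T_L T_R μ t.toNNReal (hinv _)
  rwa [Real.coe_toNNReal t ht] at h

/-- **The work-rate and kinetic-energy observables are in `L¹(μ)` under an exponential moment.**
For the pinned chain (`ω₂ > 0`, `lam, β, γ ≥ 0`) and a measure `μ` with `e^{ϑH} ∈ L¹(μ)` for some
`ϑ > 0`: `p_i ∂_{q_i}H ∈ L¹(μ)` and `p_i²/2 ∈ L¹(μ)` — by the linear force bound of the confining chain,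
`|∂_{q_i}H| ≤ K_E (1 + H)`, `|p_i| ≤ 1 + H`, and `(1 + H)² ≤ 2e^ϑ ϑ⁻² e^{ϑH}`. [folklore] -/
theorem pinnedChain_integrable_momentum_mul_partialQ (μ : Measure (PhaseSpace N)) {ϑ : ℝ}
    (hϑ : 0 < ϑ)
    (hint : Integrable (fun x => Real.exp (ϑ * (pinnedChain ω₂ lam β γ).hamiltonian N x)) μ)
    (i : Fin N) :
    Integrable (fun x : PhaseSpace N =>
        x.2 i * partialQ i ((pinnedChain ω₂ lam β γ).hamiltonian N) x) μ ∧
      Integrable (fun x : PhaseSpace N => x.2 i ^ 2 / 2) μ := by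
  have hP := pinnedChain_isConfining hω hl hβ hγ
  set K := hP.energyRate N with hK
  have hK0 : 0 ≤ K := hP.energyRate_nonneg N
  have hH1 : ContDiff ℝ 1 ((pinnedChain ω₂ lam β γ).hamiltonian N) :=
    (hP.contDiff_hamiltonian N).of_le (by norm_num)
  have hgc : Continuous fun x : PhaseSpace N =>
      x.2 i * partialQ i ((pinnedChain ω₂ lam β γ).hamiltonian N) x :=
    ((continuous_apply i).comp continuous_snd).mul
      ((pinnedChain ω₂ lam β γ).continuous_partialQ_hamiltonian hH1 i)
  -- pointwise bounds
  have hbound : ∀ x : PhaseSpace N,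
      |x.2 i * partialQ i ((pinnedChain ω₂ lam β γ).hamiltonian N) x| ≤
        K * (2 * Real.exp ϑ / ϑ ^ 2) * Real.exp (ϑ * (pinnedChain ω₂ lam β γ).hamiltonian N x) ∧
      x.2 i ^ 2 / 2 ≤
        (2 * Real.exp ϑ / ϑ ^ 2) * Real.exp (ϑ * (pinnedChain ω₂ lam β γ).hamiltonian N x) := by
    intro x
    set H := (pinnedChain ω₂ lam β γ).hamiltonian N x with hH
    have hH0 : 0 ≤ H := hP.hamiltonian_nonneg N x
    have hsite := (pinnedChain ω₂ lam β γ).site_le_hamiltonian hP.U_nonneg hP.V_nonneg N x i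
    have hU0 := hP.U_nonneg (x.1 i)
    have hp2 : x.2 i ^ 2 / 2 ≤ H := by linarith
    have hp : |x.2 i| ≤ 1 + H := by
      have := abs_le_half_add_sq_half (x.2 i)
      linarith
    have hlin := hP.linearEnergyBound N x
    have hγ' : 0 ≤ 2 * (pinnedChain ω₂ lam β γ).γ * ∑ j, |x.2 j| :=
      mul_nonneg (mul_nonneg (by norm_num) hP.γ_nonneg) (Finset.sum_nonneg fun j _ => abs_nonneg _)
    have hsingle : |partialQ i ((pinnedChain ω₂ lam β γ).hamiltonian N) x| ≤
        ∑ j, |partialQ j ((pinnedChain ω₂ lam β γ).hamiltonian N) x| :=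
      Finset.single_le_sum (f := fun j => |partialQ j ((pinnedChain ω₂ lam β γ).hamiltonian N) x|)
        (fun j _ => abs_nonneg _) (Finset.mem_univ i)
    have hforce : |partialQ i ((pinnedChain ω₂ lam β γ).hamiltonian N) x| ≤ K * (1 + H) := by
      linarith
    have hsq := one_add_sq_le_exp hH0 hϑ
    have hC0 : 0 ≤ 2 * Real.exp ϑ / ϑ ^ 2 := by positivity
    constructor
    · rw [abs_mul]
      calc |x.2 i| * |partialQ i ((pinnedChain ω₂ lam β γ).hamiltonian N) x|
          ≤ (1 + H) * (K * (1 + H)) :=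
            mul_le_mul hp hforce (abs_nonneg _) (by linarith)
        _ = K * (1 + H) ^ 2 := by ring
        _ ≤ K * (2 * Real.exp ϑ / ϑ ^ 2 * Real.exp (ϑ * H)) := mul_le_mul_of_nonneg_left hsq hK0
        _ = K * (2 * Real.exp ϑ / ϑ ^ 2) * Real.exp (ϑ * H) := by ring
    · have h1 : H ≤ (1 + H) ^ 2 := by nlinarith
      calc x.2 i ^ 2 / 2 ≤ H := hp2
        _ ≤ (1 + H) ^ 2 := h1
        _ ≤ 2 * Real.exp ϑ / ϑ ^ 2 * Real.exp (ϑ * H) := hsq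
  constructor
  · refine (hint.const_mul (K * (2 * Real.exp ϑ / ϑ ^ 2))).mono' hgc.aestronglyMeasurable
      (Eventually.of_forall fun x => ?_)
    rw [Real.norm_eq_abs]
    exact (hbound x).1
  · have hc2 : Continuous fun x : PhaseSpace N => x.2 i ^ 2 / 2 := by fun_prop
    refine (hint.const_mul (2 * Real.exp ϑ / ϑ ^ 2)).mono' hc2.aestronglyMeasurable
      (Eventually.of_forall fun x => ?_)
    rw [Real.norm_eq_abs, abs_of_nonneg (by positivity)]
    exact (hbound x).2

/-- The `x_0`-marginal of `fluxLaw μ` is `μ`. [folklore] -/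
theorem fluxLaw_map_fst (μ : Measure (PhaseSpace N)) [SFinite μ] (i0 iN ib : Fin N) (t : ℝ) :
    (fluxLaw (pinnedChain ω₂ lam β γ) N i0 iN ib T_L T_R t μ).map Prod.fst = μ := by
  rw [fluxLaw_eq, Measure.map_map measurable_fst (EquilibriumBondHeatVariance.measurable_rawObs_fwdPath hω hl hβ hγ N T_L T_R i0 iN ib t)]
  have h : (Prod.fst ∘ fun zw : PhaseSpace N × WienerPair =>
      rawObs (pinnedChain ω₂ lam β γ) N i0 iN ib t zw.1 (fwdPath (pinnedChain ω₂ lam β γ) N T_L T_R zw.1 zw.2)) =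
      Prod.fst := rfl
  rw [h, Measure.map_fst_prod, measure_univ, one_smul]

/-- The `x_t`-marginal of `fluxLaw μ` is `μ` when `μ` is invariant under the constructed kernels
(`t ≥ 0`). [folklore] -/
theorem fluxLaw_map_endpoint (μ : Measure (PhaseSpace N)) [SFinite μ]
    (hinv : ∀ s : ℝ≥0, μ.bind ((pinnedChain ω₂ lam β γ).transitionKernel N T_L T_R s) = μ)
    (i0 iN ib : Fin N) {t : ℝ} (ht : 0 ≤ t) :
    (fluxLaw (pinnedChain ω₂ lam β γ) N i0 iN ib T_L T_R t μ).map (fun y => y.2.1) = μ := by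
  have hm : Measurable fun y : Obs N => y.2.1 := measurable_fst.comp measurable_snd
  rw [fluxLaw_eq, Measure.map_map hm (EquilibriumBondHeatVariance.measurable_rawObs_fwdPath hω hl hβ hγ N T_L T_R i0 iN ib t)]
  exact pinnedChain_map_solMap_real_of_invariant hω hl hβ hγ N T_L T_R μ hinv ht

end Law

/-- **Both bath heats are integrable under the stationary endpoint–heat law.** For the pinned chain
(`ω₂ > 0`, `lam, β, γ ≥ 0`), a probability measure `μ` invariant under the constructed kernels with
`e^{ϑH} ∈ L¹(μ)` for some `ϑ > 0`, and `t ≥ 0`: the heats `Q_i = p_i(t)²/2 - p_i(0)²/2 + I_i`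
(`leftHeat i0`, `rightHeat iN`) are integrable under `fluxLaw μ` — the kinetic terms because both
endpoints have law `μ` and `p_i²/2 ≤ H ≤ C e^{ϑH}`, the work integrals `I_i = ∫₀ᵗ p_i ∂_{q_i}H ds` by
Tonelli and the one-time law (`E|I_i| ≤ t μ(|p_i ∂_{q_i}H|) < ∞`). Registered sub-goal of crux
stmt-AtomisticToContinuum-9122 (stub `stub_entropyBalance`). [folklore] -/
theorem integrable_heats_fluxLaw :
    ∀ (ω₂ lam β γ : ℝ), 0 < ω₂ → 0 ≤ lam → 0 ≤ β → 0 ≤ γ → ∀ (N : ℕ) (T_L T_R : ℝ)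
      (μ : Measure (PhaseSpace N)) [IsProbabilityMeasure μ],
      (∀ s : ℝ≥0, μ.bind ((pinnedChain ω₂ lam β γ).transitionKernel N T_L T_R s) = μ) →
      ∀ (ϑ : ℝ), 0 < ϑ → Integrable (fun x => Real.exp (ϑ * (pinnedChain ω₂ lam β γ).hamiltonian N x)) μ →
      ∀ (i0 iN ib : Fin N) (t : ℝ), 0 ≤ t →
      Integrable (leftHeat i0) (fluxLaw (pinnedChain ω₂ lam β γ) N i0 iN ib T_L T_R t μ) ∧
        Integrable (rightHeat iN) (fluxLaw (pinnedChain ω₂ lam β γ) N i0 iN ib T_L T_R t μ) := by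
  intro ω₂ lam β γ hω hl hβ hγ N T_L T_R μ _ hinv ϑ hϑ hint i0 iN ib t ht
  have hobs := EquilibriumBondHeatVariance.measurable_rawObs_fwdPath hω hl hβ hγ N T_L T_R i0 iN ib t
  have hfst := fluxLaw_map_fst hω hl hβ hγ N T_L T_R μ i0 iN ib t
  have hend := fluxLaw_map_endpoint hω hl hβ hγ N T_L T_R μ hinv i0 iN ib ht
  set Pf := fluxLaw (pinnedChain ω₂ lam β γ) N i0 iN ib T_L T_R t μ with hPf
  -- kinetic terms
  have hkin : ∀ i : Fin N, Integrable (fun y : Obs N => y.1.2 i ^ 2 / 2) Pf ∧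
      Integrable (fun y : Obs N => y.2.1.2 i ^ 2 / 2) Pf := by
    intro i
    have hk := (pinnedChain_integrable_momentum_mul_partialQ hω hl hβ hγ N μ hϑ hint i).2
    have hkm : Measurable fun x : PhaseSpace N => x.2 i ^ 2 / 2 := by fun_prop
    constructor
    · have h1 : Integrable (fun x : PhaseSpace N => x.2 i ^ 2 / 2) (Pf.map Prod.fst) := by rwa [hfst]
      exact (integrable_map_measure hkm.aestronglyMeasurable measurable_fst.aemeasurable).1 h1
    · have h1 : Integrable (fun x : PhaseSpace N => x.2 i ^ 2 / 2) (Pf.map fun y => y.2.1) := by rwa [hend]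
      exact (integrable_map_measure hkm.aestronglyMeasurable
        (measurable_fst.comp measurable_snd).aemeasurable).1 h1
  -- work integrals
  have hP := pinnedChain_isConfining hω hl hβ hγ
  have hH1 : ContDiff ℝ 1 ((pinnedChain ω₂ lam β γ).hamiltonian N) :=
    (hP.contDiff_hamiltonian N).of_le (by norm_num)
  have hg : ∀ i : Fin N, Measurable fun x : PhaseSpace N =>
      x.2 i * partialQ i ((pinnedChain ω₂ lam β γ).hamiltonian N) x := fun i =>
    (((continuous_apply i).comp continuous_snd).mul
      ((pinnedChain ω₂ lam β γ).continuous_partialQ_hamiltonian hH1 i)).measurable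
  have hwork : ∀ i : Fin N, Integrable (fun p : PhaseSpace N × WienerPair =>
      workIntegral (pinnedChain ω₂ lam β γ) N i t (fwdPath (pinnedChain ω₂ lam β γ) N T_L T_R p.1 p.2))
      (μ.prod wienerPair) := fun i =>
    pinnedChain_integrable_intervalIntegral_of_invariant ω₂ lam β γ hω hl hβ hγ N T_L T_R μ hinv _ (hg i)
      (pinnedChain_integrable_momentum_mul_partialQ hω hl hβ hγ N μ hϑ hint i).1 t ht
  have hI0 : Integrable (fun y : Obs N => y.2.2.1) Pf := by
    refine (integrable_map_measure (by fun_prop) hobs.aemeasurable).2 ?_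
    exact hwork i0
  have hIN : Integrable (fun y : Obs N => y.2.2.2.1) Pf := by
    refine (integrable_map_measure (by fun_prop) hobs.aemeasurable).2 ?_
    exact hwork iN
  constructor
  · have h := ((hkin i0).2.sub (hkin i0).1).add hI0
    exact h
  · have h := ((hkin iN).2.sub (hkin iN).1).add hIN
    exact h



end Summit.AtomisticToContinuum.FouriersLaw.Theorems.LinearResponseFTUR

end
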